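import Summits.QuantumFields.YangMills.Theorems.BalabanUVNodesPortS1QtCPsi
import Literature.Analysis.Complex.HolomorphicBanach

/-!
# Port S1, socket (o3) bricks II — `C̃_ℂ` IS FRÉCHET-ANALYTIC ON ITS BALL; THE `9C₂ρ`-LIPSCHITZ BOUND ON THE `2ρ`-BALL; `Ψ(B′) = B′ + h_ℂ C̃_ℂ(B′)` IS STRICTLY DIFFERENTIABLE,
# INJECTIVE ON THE `2ρ`-BALL, AND `DΨ(B′) = 1 + h_ℂ∘DC̃_ℂ(B′)` IS A UNIT THERE (`‖h_ℂ∘DC̃_ℂ(B′)‖ ≤ 9C₂bρ < 1`)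

Cell `ym-nodeO-ideate`, porter seat PT-A-1 (gen 10); `--kind proof --supports stmt-QuantumFields-27930 --as helper`; count-neutral.  [I] = [Balaban1987RG1]; [15] = [Balaban1985Variational].
Director-ym №607 ∕ R702-ym docket (1): «(o3) det∕Tr-log of `1 + h_ℂ∘DC̃_ℂ(B′)`».  This file is the `Dt`-FREE half of the road to the Fréchet-holomorphy of `D̃ = recordDt` and to the Jacobian identity
`1 − h_ℂ∘DD̃(B) = (DΨ(Φ B))⁻¹` (next file `…PortS1RecordDtHol`): everything print's change of variables needs about `Ψ` on the ball of radius `2ρ ⊇ Φ(ball ρ)`.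

WHAT IS PROVED (`R = 1∕(10⁸dL)`, `C₂ = 2∕R²`; letters (o1-ε): loops `ε`-close, `ε ≤ 1∕50`, the (0.4) guard; `‖h_ℂ‖ ≤ b`, `9C₂bρ < 1`, `3ρ ≤ R`):
* §1 ★ `analyticOnNhd_recordCtC_ball` — `C̃_ℂ` is ANALYTIC (Taylor series at every point) on the open ball `‖Y‖ < R` (tree ✓`HolomorphicBanach.analyticOnNhd_of_differentiableOn`, [Chae1985] Thm 14.13, over
  ✓`differentiableOn_recordCtC_ball`); `contDiffAt_recordCtC`, ★ `hasStrictFDerivAt_recordCtC`.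
* §2 ★★ `norm_fderiv_recordCtC_le_of_lt_two_mul` — CAUCHY AT RADIUS `ρ`: `‖DC̃_ℂ(Y)‖ ≤ 9C₂ρ` for `‖Y‖ < 2ρ`, `3ρ ≤ R` (circle `|ζ| = ρ∕‖Q‖` stays in `‖·‖ < 3ρ ≤ R` where `‖C̃_ℂ‖ ≤ C₂(3ρ)²`); ★★
  `norm_recordCtC_sub_le` — the `9C₂ρ`-LIPSCHITZ bound on the convex ball `2ρ` (mean value inequality) = [15] (53)–(54) between two base points.
* §3 ★ `hasStrictFDerivAt_recordPsi`; ★★ `norm_hop_comp_fderiv_recordCtC_le_of_lt_two_mul` (`≤ 9C₂bρ`), ★★ `isUnit_fderiv_recordPsi_of_lt_two_mul` — `DΨ(Y)` is a unit for EVERY `‖Y‖ < 2ρ`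
  (Neumann; the landed ✓`isUnit_fderiv_recordPsi` covers `‖Y‖ < ρ` only, while `Φ(ball ρ) ⊆ ball 2ρ`); ★★ `injOn_recordPsi_ball_two_mul` — `Ψ` is injective on the `2ρ`-ball (`‖Y₁ − Y₂‖ ≤ 9C₂bρ‖Y₁ − Y₂‖`).

HONEST FRAMING.  Calculus∕bookkeeping over landed one-step estimates; nothing of Bałaban's renormalization-group estimates asserted, ported or discharged beyond this; `det`∕`Tr log` and `D̃`'s derivative
are the next file; `stub_FE` (XXL) ∕ `stub_P0C` OPEN, ⟨27930⟩ OPEN (1∕3); NODE O 0∕1; COUNT 8∕28 · K 1∕4 UNMOVED; finite `𝕋⁴_{L^K}` at fixed ε — NOT continuum ∕ OS; **the Yang–Mills mass gap (Clay) is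
NOT proved by any of this.**  No `sorry`, no `def`, no `instance`; standard axioms only.
-/

noncomputable section

open scoped BigOperators Matrix.Norms.L2Operator Topology

open Set Metric Filter

namespace Summit.QuantumFields.YangMills.Theorems.BalabanUVNodesPortS1

open Summit.QuantumFields.YangMills.Theorems.K0RecordFormatNames
open Literature.MathematicalPhysics.QuantumFieldTheory.Balaban1983to89
open Literature.MathematicalPhysics.QuantumFieldTheory.Balaban1983to89.Node00
open Literature.MathematicalPhysics.QuantumFieldTheory.Balaban1983to89.T4Continuum (T4Family)
open Literature.MathematicalPhysics.QuantumFieldTheory.Balaban1983to89.BlockAveraging (Small Idx)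
open Literature.MathematicalPhysics.QuantumFieldTheory.Balaban1983to89.ExpMeanLog (expMeanLogSU)
open _root_.Matrix

variable (F : T4Family)

/-! ## §1  `C̃_ℂ` is analytic on the open ball; strict differentiability -/

/-- ★ **`C̃_ℂ(Vk)` IS ANALYTIC ON THE OPEN BALL `‖Y‖ < R`** (Fréchet-holomorphic on an open set of a complex normed space with values in a Banach space ⇒ analytic, [Chae1985] Thm 14.13 — the tree's
✓`HolomorphicBanach.analyticOnNhd_of_differentiableOn`). [cite: Balaban1987RG1, p.267 («an analytic function of B»)] -/
theorem analyticOnNhd_recordCtC_ball (k K : ℕ) (hk : k + 1 ≤ (F.P K).m + (F.P K).K) (Vk : GaugeField (F.P K) k (SU 2)) {ε : ℝ}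
    (hε : ∀ (c : PBond (F.P K) (k + 1)) (i : Idx (F.P K)), ‖loopM (coeField Vk) c i - 1‖ ≤ ε) (hε50 : ε ≤ 1 / 50)
    (hVk : ∀ c, Small expMeanLogSU Vk c) :
    AnalyticOnNhd ℂ (recordCtC F k K Vk) (ball (0 : FluctIdx F k K → ℂ) (1 / (10 ^ 8 * (F.P K).d * (F.P K).L))) := by
  have hset : {Y : FluctIdx F k K → ℂ | ‖Y‖ < 1 / (10 ^ 8 * (F.P K).d * (F.P K).L)} = ball 0 (1 / (10 ^ 8 * (F.P K).d * (F.P K).L)) := by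
    ext Y; simp
  have hd := differentiableOn_recordCtC_ball F k K hk Vk hε hε50 hVk
  rw [hset] at hd
  exact Literature.Analysis.Complex.HolomorphicBanach.analyticOnNhd_of_differentiableOn hd isOpen_ball

/-- `C̃_ℂ(Vk)` is `C^n` (every `n`) at every point of the open ball. [cite: Balaban1987RG1, p.267] -/
theorem contDiffAt_recordCtC (k K : ℕ) (hk : k + 1 ≤ (F.P K).m + (F.P K).K) (Vk : GaugeField (F.P K) k (SU 2)) {ε : ℝ}
    (hε : ∀ (c : PBond (F.P K) (k + 1)) (i : Idx (F.P K)), ‖loopM (coeField Vk) c i - 1‖ ≤ ε) (hε50 : ε ≤ 1 / 50)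
    (hVk : ∀ c, Small expMeanLogSU Vk c) {Y : FluctIdx F k K → ℂ} (hY : ‖Y‖ < 1 / (10 ^ 8 * (F.P K).d * (F.P K).L)) {n : WithTop ℕ∞} :
    ContDiffAt ℂ n (recordCtC F k K Vk) Y :=
  ((analyticOnNhd_recordCtC_ball F k K hk Vk hε hε50 hVk) Y (mem_ball_zero_iff.2 hY)).contDiffAt

/-- ★ `C̃_ℂ(Vk)` is STRICTLY differentiable at every point of the open ball (analytic ⇒ `C¹` ⇒ strict). [cite: Balaban1987RG1, p.267] -/
theorem hasStrictFDerivAt_recordCtC (k K : ℕ) (hk : k + 1 ≤ (F.P K).m + (F.P K).K) (Vk : GaugeField (F.P K) k (SU 2)) {ε : ℝ}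
    (hε : ∀ (c : PBond (F.P K) (k + 1)) (i : Idx (F.P K)), ‖loopM (coeField Vk) c i - 1‖ ≤ ε) (hε50 : ε ≤ 1 / 50)
    (hVk : ∀ c, Small expMeanLogSU Vk c) {Y : FluctIdx F k K → ℂ} (hY : ‖Y‖ < 1 / (10 ^ 8 * (F.P K).d * (F.P K).L)) :
    HasStrictFDerivAt (recordCtC F k K Vk) (fderiv ℂ (recordCtC F k K Vk) Y) Y :=
  (contDiffAt_recordCtC F k K hk Vk hε hε50 hVk hY (n := 1)).hasStrictFDerivAt one_ne_zero

/-! ## §2  Cauchy at radius `ρ`: `‖DC̃_ℂ(Y)‖ ≤ 9C₂ρ` on `‖Y‖ < 2ρ`, and the Lipschitz bound -/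

/-- ★★ **CAUCHY BOUND AT RADIUS `ρ`**: `‖DC̃_ℂ(Y)‖ ≤ 9C₂ρ` for `‖Y‖ < 2ρ`, `3ρ ≤ R` — along `ζ ↦ Y + ζQ` the circle `|ζ| = ρ∕‖Q‖` lies in `‖·‖ < 3ρ ≤ R`, where `‖C̃_ℂ‖ ≤ C₂(3ρ)²`; Cauchy's estimate gives
`‖DC̃_ℂ(Y)Q‖ ≤ C₂(3ρ)²∕(ρ∕‖Q‖) = 9C₂ρ‖Q‖` (= [15] (53)–(54) «Taking r = ε₃(B₀|X₁ − X₂|)⁻¹ … = 9C₂B₀ε₃|X₁ − X₂|»). [cite: Balaban1985Variational, (53)–(54) p.286; Balaban1987RG1, p.267] -/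
theorem norm_fderiv_recordCtC_le_of_lt_two_mul (k K : ℕ) (hk : k + 1 ≤ (F.P K).m + (F.P K).K) (Vk : GaugeField (F.P K) k (SU 2)) {ε : ℝ}
    (hε : ∀ (c : PBond (F.P K) (k + 1)) (i : Idx (F.P K)), ‖loopM (coeField Vk) c i - 1‖ ≤ ε) (hε50 : ε ≤ 1 / 50)
    (hVk : ∀ c, Small expMeanLogSU Vk c) {ρ : ℝ} (hρ : 3 * ρ ≤ 1 / (10 ^ 8 * (F.P K).d * (F.P K).L))
    {Y : FluctIdx F k K → ℂ} (hY : ‖Y‖ < 2 * ρ) :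
    ‖fderiv ℂ (recordCtC F k K Vk) Y‖ ≤ 9 * (2 * 1 / (1 / (10 ^ 8 * (F.P K).d * (F.P K).L)) ^ 2) * ρ := by
  have hQA := quadAnalytic_recordCtC F k K hk Vk hε hε50 hVk
  have hρ0 : 0 < ρ := by linarith [norm_nonneg Y]
  have hYR : ‖Y‖ < 1 / (10 ^ 8 * (F.P K).d * (F.P K).L) := by linarith
  have hdiff := differentiableAt_recordCtC F k K hk Vk hε hε50 hVk hYR
  have hC₂0 : (0 : ℝ) ≤ 2 * 1 / (1 / (10 ^ 8 * (F.P K).d * (F.P K).L)) ^ 2 := by positivity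
  refine ContinuousLinearMap.opNorm_le_bound _ (by positivity) fun Q => ?_
  by_cases hQ0 : Q = 0
  · subst hQ0; simp
  have hQn : 0 < ‖Q‖ := norm_pos_iff.2 hQ0
  set r : ℝ := ρ / ‖Q‖ with hrdef
  have hr : 0 < r := div_pos hρ0 hQn
  have hrQ : r * ‖Q‖ = ρ := by rw [hrdef]; field_simp
  set g : ℂ → (PBond (F.P K) (k + 1) → MatA 2) := fun ζ => recordCtC F k K Vk (Y + ζ • Q) with hgdef
  have hline : HasDerivAt (fun ζ : ℂ => Y + ζ • Q) Q 0 := by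
    simpa using ((hasDerivAt_id (0 : ℂ)).smul_const Q).const_add Y
  have hg : HasDerivAt g (fderiv ℂ (recordCtC F k K Vk) Y Q) 0 := by
    have h2 : HasFDerivAt (recordCtC F k K Vk) (fderiv ℂ (recordCtC F k K Vk) Y) (Y + (0 : ℂ) • Q) := by
      rw [zero_smul, add_zero]; exact hdiff.hasFDerivAt
    exact h2.comp_hasDerivAt (0 : ℂ) hline
  -- on the closed disc `|ζ| ≤ r` the line stays in `‖·‖ < 3ρ ≤ R`
  have hin : ∀ ζ : ℂ, ‖ζ‖ ≤ r → ‖Y + ζ • Q‖ < 3 * ρ := fun ζ hζ => by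
    calc ‖Y + ζ • Q‖ ≤ ‖Y‖ + ‖ζ • Q‖ := norm_add_le _ _
      _ = ‖Y‖ + ‖ζ‖ * ‖Q‖ := by rw [norm_smul]
      _ ≤ ‖Y‖ + r * ‖Q‖ := by gcongr
      _ < 2 * ρ + ρ := by rw [hrQ]; linarith
      _ = 3 * ρ := by ring
  have hsphere : ∀ ζ ∈ sphere (0 : ℂ) r, ‖g ζ‖ ≤ (2 * 1 / (1 / (10 ^ 8 * (F.P K).d * (F.P K).L)) ^ 2) * (3 * ρ) ^ 2 := by
    intro ζ hζ
    have hζ' : ‖ζ‖ ≤ r := by rw [mem_sphere_zero_iff_norm.1 hζ]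
    have hlt : ‖Y + ζ • Q‖ < 1 / (10 ^ 8 * (F.P K).d * (F.P K).L) := (hin ζ hζ').trans_le hρ
    calc ‖g ζ‖ ≤ (2 * 1 / (1 / (10 ^ 8 * (F.P K).d * (F.P K).L)) ^ 2) * ‖Y + ζ • Q‖ ^ 2 := hQA.quad _ hlt
      _ ≤ (2 * 1 / (1 / (10 ^ 8 * (F.P K).d * (F.P K).L)) ^ 2) * (3 * ρ) ^ 2 := by
          gcongr; exact (hin ζ hζ').le
  have hsub : closure (ball (0 : ℂ) r) ⊆ {ζ : ℂ | ‖Y + ζ • Q‖ < 1 / (10 ^ 8 * (F.P K).d * (F.P K).L)} := by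
    intro ζ hζ
    have hζ' : ‖ζ‖ ≤ r := by
      have := closure_ball_subset_closedBall hζ
      rwa [mem_closedBall_zero_iff] at this
    show ‖Y + ζ • Q‖ < _
    exact (hin ζ hζ').trans_le hρ
  have hdc : DiffContOnCl ℂ g (ball (0 : ℂ) r) := ((hQA.lineAnalytic Y Q).mono hsub).diffContOnCl
  have hC := Complex.norm_deriv_le_of_forall_mem_sphere_norm_le hr hdc hsphere
  rw [hg.deriv] at hC
  calc ‖fderiv ℂ (recordCtC F k K Vk) Y Q‖ ≤ (2 * 1 / (1 / (10 ^ 8 * (F.P K).d * (F.P K).L)) ^ 2) * (3 * ρ) ^ 2 / r := hC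
    _ = 9 * (2 * 1 / (1 / (10 ^ 8 * (F.P K).d * (F.P K).L)) ^ 2) * ρ * ‖Q‖ := by
        rw [hrdef]; field_simp; ring

/-- ★★ **THE `9C₂ρ`-LIPSCHITZ BOUND ON THE `2ρ`-BALL**: `‖C̃_ℂ(Y₁) − C̃_ℂ(Y₂)‖ ≤ 9C₂ρ‖Y₁ − Y₂‖` for `‖Y₁‖, ‖Y₂‖ < 2ρ`, `3ρ ≤ R` (mean value inequality on the convex ball with §2's derivative bound) —
[15] (53)–(54) between two base points. [cite: Balaban1985Variational, (53)–(54) p.286; Balaban1987RG1, p.267] -/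
theorem norm_recordCtC_sub_le (k K : ℕ) (hk : k + 1 ≤ (F.P K).m + (F.P K).K) (Vk : GaugeField (F.P K) k (SU 2)) {ε : ℝ}
    (hε : ∀ (c : PBond (F.P K) (k + 1)) (i : Idx (F.P K)), ‖loopM (coeField Vk) c i - 1‖ ≤ ε) (hε50 : ε ≤ 1 / 50)
    (hVk : ∀ c, Small expMeanLogSU Vk c) {ρ : ℝ} (hρ : 3 * ρ ≤ 1 / (10 ^ 8 * (F.P K).d * (F.P K).L))
    {Y₁ Y₂ : FluctIdx F k K → ℂ} (hY₁ : ‖Y₁‖ < 2 * ρ) (hY₂ : ‖Y₂‖ < 2 * ρ) :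
    ‖recordCtC F k K Vk Y₁ - recordCtC F k K Vk Y₂‖ ≤ 9 * (2 * 1 / (1 / (10 ^ 8 * (F.P K).d * (F.P K).L)) ^ 2) * ρ * ‖Y₁ - Y₂‖ := by
  have hdiff : ∀ Y ∈ ball (0 : FluctIdx F k K → ℂ) (2 * ρ), DifferentiableAt ℂ (recordCtC F k K Vk) Y := fun Y hY => by
    have hY' : ‖Y‖ < 2 * ρ := mem_ball_zero_iff.1 hY
    exact differentiableAt_recordCtC F k K hk Vk hε hε50 hVk (by linarith [norm_nonneg Y])
  have hbound : ∀ Y ∈ ball (0 : FluctIdx F k K → ℂ) (2 * ρ),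
      ‖fderiv ℂ (recordCtC F k K Vk) Y‖ ≤ 9 * (2 * 1 / (1 / (10 ^ 8 * (F.P K).d * (F.P K).L)) ^ 2) * ρ := fun Y hY =>
    norm_fderiv_recordCtC_le_of_lt_two_mul F k K hk Vk hε hε50 hVk hρ (mem_ball_zero_iff.1 hY)
  exact (convex_ball (0 : FluctIdx F k K → ℂ) (2 * ρ)).norm_image_sub_le_of_norm_fderiv_le hdiff hbound
    (mem_ball_zero_iff.2 hY₂) (mem_ball_zero_iff.2 hY₁)

/-! ## §3  `Ψ(B′) = B′ + h_ℂ C̃_ℂ(B′)` on the `2ρ`-ball: strict derivative, unit, injectivity -/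

/-- ★ **`Ψ` IS STRICTLY DIFFERENTIABLE** with derivative `1 + h_ℂ ∘ DC̃_ℂ(B′)` at every `‖B′‖ < R`. [cite: Balaban1987RG1, p.267–268] -/
theorem hasStrictFDerivAt_recordPsi (k K : ℕ) (hk : k + 1 ≤ (F.P K).m + (F.P K).K) (Vk : GaugeField (F.P K) k (SU 2)) {ε : ℝ}
    (hε : ∀ (c : PBond (F.P K) (k + 1)) (i : Idx (F.P K)), ‖loopM (coeField Vk) c i - 1‖ ≤ ε) (hε50 : ε ≤ 1 / 50)
    (hVk : ∀ c, Small expMeanLogSU Vk c) {Y : FluctIdx F k K → ℂ} (hY : ‖Y‖ < 1 / (10 ^ 8 * (F.P K).d * (F.P K).L)) :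
    HasStrictFDerivAt (fun B' : FluctIdx F k K → ℂ => B' + hopLinGraphC F k K Vk (recordCtC F k K Vk B'))
      ((1 : (FluctIdx F k K → ℂ) →L[ℂ] (FluctIdx F k K → ℂ)) +
        (LinearMap.toContinuousLinearMap (hopLinGraphC F k K Vk)).comp (fderiv ℂ (recordCtC F k K Vk) Y)) Y := by
  have h1 : HasStrictFDerivAt (fun B' : FluctIdx F k K → ℂ => B') (1 : (FluctIdx F k K → ℂ) →L[ℂ] (FluctIdx F k K → ℂ)) Y :=
    hasStrictFDerivAt_id Y
  have h2 : HasStrictFDerivAt (fun B' => hopLinGraphC F k K Vk (recordCtC F k K Vk B'))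
      ((LinearMap.toContinuousLinearMap (hopLinGraphC F k K Vk)).comp (fderiv ℂ (recordCtC F k K Vk) Y)) Y :=
    (LinearMap.toContinuousLinearMap (hopLinGraphC F k K Vk)).hasStrictFDerivAt.comp Y
      (hasStrictFDerivAt_recordCtC F k K hk Vk hε hε50 hVk hY)
  exact h1.add h2

/-- ★★ `‖h_ℂ ∘ DC̃_ℂ(B′)‖ ≤ 9C₂bρ` for EVERY `‖B′‖ < 2ρ` (`3ρ ≤ R`, `‖h_ℂ‖ ≤ b`). [cite: Balaban1985Variational, (54) p.286, (98) p.292; Balaban1987RG1, p.267] -/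
theorem norm_hop_comp_fderiv_recordCtC_le_of_lt_two_mul (k K : ℕ) (hk : k + 1 ≤ (F.P K).m + (F.P K).K) (Vk : GaugeField (F.P K) k (SU 2)) {ε : ℝ}
    (hε : ∀ (c : PBond (F.P K) (k + 1)) (i : Idx (F.P K)), ‖loopM (coeField Vk) c i - 1‖ ≤ ε) (hε50 : ε ≤ 1 / 50)
    (hVk : ∀ c, Small expMeanLogSU Vk c) {b ρ : ℝ} (hb : 0 ≤ b) (hHop : ∀ X, ‖hopLinGraphC F k K Vk X‖ ≤ b * ‖X‖)
    (hρ : 3 * ρ ≤ 1 / (10 ^ 8 * (F.P K).d * (F.P K).L)) {Y : FluctIdx F k K → ℂ} (hY : ‖Y‖ < 2 * ρ) :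
    ‖(LinearMap.toContinuousLinearMap (hopLinGraphC F k K Vk)).comp (fderiv ℂ (recordCtC F k K Vk) Y)‖ ≤
      9 * (2 * 1 / (1 / (10 ^ 8 * (F.P K).d * (F.P K).L)) ^ 2) * b * ρ := by
  have hh : ‖LinearMap.toContinuousLinearMap (hopLinGraphC F k K Vk)‖ ≤ b :=
    ContinuousLinearMap.opNorm_le_bound _ hb fun X => hHop X
  have hρ0 : 0 < ρ := by linarith [norm_nonneg Y]
  have hC₂0 : (0 : ℝ) ≤ 2 * 1 / (1 / (10 ^ 8 * (F.P K).d * (F.P K).L)) ^ 2 := by positivity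
  calc ‖(LinearMap.toContinuousLinearMap (hopLinGraphC F k K Vk)).comp (fderiv ℂ (recordCtC F k K Vk) Y)‖
      ≤ ‖LinearMap.toContinuousLinearMap (hopLinGraphC F k K Vk)‖ * ‖fderiv ℂ (recordCtC F k K Vk) Y‖ := ContinuousLinearMap.opNorm_comp_le _ _
    _ ≤ b * (9 * (2 * 1 / (1 / (10 ^ 8 * (F.P K).d * (F.P K).L)) ^ 2) * ρ) :=
        mul_le_mul hh (norm_fderiv_recordCtC_le_of_lt_two_mul F k K hk Vk hε hε50 hVk hρ hY) (norm_nonneg (fderiv ℂ (recordCtC F k K Vk) Y)) hb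
    _ = 9 * (2 * 1 / (1 / (10 ^ 8 * (F.P K).d * (F.P K).L)) ^ 2) * b * ρ := by ring

/-- ★★ **`DΨ(B′) = 1 + h_ℂ∘DC̃_ℂ(B′)` IS A UNIT FOR EVERY `‖B′‖ < 2ρ`** under `9C₂bρ < 1`, `3ρ ≤ R` (Neumann series; `‖h_ℂ∘DC̃_ℂ(B′)‖ ≤ 9C₂bρ < 1`) — in particular at every `B′ = Φ(B)`, `‖B‖ < ρ`.
[cite: Balaban1987RG1, (2.12) p.268; Balaban1985Variational, (98) p.292] -/
theorem isUnit_fderiv_recordPsi_of_lt_two_mul (k K : ℕ) (hk : k + 1 ≤ (F.P K).m + (F.P K).K) (Vk : GaugeField (F.P K) k (SU 2)) {ε : ℝ}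
    (hε : ∀ (c : PBond (F.P K) (k + 1)) (i : Idx (F.P K)), ‖loopM (coeField Vk) c i - 1‖ ≤ ε) (hε50 : ε ≤ 1 / 50)
    (hVk : ∀ c, Small expMeanLogSU Vk c) {b ρ : ℝ} (hb : 0 ≤ b) (hHop : ∀ X, ‖hopLinGraphC F k K Vk X‖ ≤ b * ‖X‖)
    (hq : 9 * (2 * 1 / (1 / (10 ^ 8 * (F.P K).d * (F.P K).L)) ^ 2) * b * ρ < 1) (hρ : 3 * ρ ≤ 1 / (10 ^ 8 * (F.P K).d * (F.P K).L))
    {Y : FluctIdx F k K → ℂ} (hY : ‖Y‖ < 2 * ρ) :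
    ‖(LinearMap.toContinuousLinearMap (hopLinGraphC F k K Vk)).comp (fderiv ℂ (recordCtC F k K Vk) Y)‖ < 1 ∧
      IsUnit ((1 : (FluctIdx F k K → ℂ) →L[ℂ] (FluctIdx F k K → ℂ)) +
        (LinearMap.toContinuousLinearMap (hopLinGraphC F k K Vk)).comp (fderiv ℂ (recordCtC F k K Vk) Y)) := by
  have hlt : ‖(LinearMap.toContinuousLinearMap (hopLinGraphC F k K Vk)).comp (fderiv ℂ (recordCtC F k K Vk) Y)‖ < 1 :=
    (norm_hop_comp_fderiv_recordCtC_le_of_lt_two_mul F k K hk Vk hε hε50 hVk hb hHop hρ hY).trans_lt hq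
  refine ⟨hlt, ?_⟩
  have hu : IsUnit ((1 : (FluctIdx F k K → ℂ) →L[ℂ] (FluctIdx F k K → ℂ)) -
      -((LinearMap.toContinuousLinearMap (hopLinGraphC F k K Vk)).comp (fderiv ℂ (recordCtC F k K Vk) Y))) :=
    (Units.oneSub (-((LinearMap.toContinuousLinearMap (hopLinGraphC F k K Vk)).comp (fderiv ℂ (recordCtC F k K Vk) Y)))
      (by rwa [norm_neg])).isUnit
  rwa [sub_neg_eq_add] at hu

/-- ★★ **`Ψ` IS INJECTIVE ON THE `2ρ`-BALL**: `Ψ Y₁ = Ψ Y₂` gives `Y₁ − Y₂ = −h_ℂ(C̃_ℂ Y₁ − C̃_ℂ Y₂)`, whose norm is `≤ 9C₂bρ‖Y₁ − Y₂‖ < ‖Y₁ − Y₂‖` unless `Y₁ = Y₂` — so `Φ = Ψ⁻¹` on `Φ(ball ρ) ⊆ ball 2ρ`.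
[cite: Balaban1987RG1, p.267–268; Balaban1985Variational, (54) p.286] -/
theorem injOn_recordPsi_ball_two_mul (k K : ℕ) (hk : k + 1 ≤ (F.P K).m + (F.P K).K) (Vk : GaugeField (F.P K) k (SU 2)) {ε : ℝ}
    (hε : ∀ (c : PBond (F.P K) (k + 1)) (i : Idx (F.P K)), ‖loopM (coeField Vk) c i - 1‖ ≤ ε) (hε50 : ε ≤ 1 / 50)
    (hVk : ∀ c, Small expMeanLogSU Vk c) {b ρ : ℝ} (hb : 0 ≤ b) (hHop : ∀ X, ‖hopLinGraphC F k K Vk X‖ ≤ b * ‖X‖)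
    (hq : 9 * (2 * 1 / (1 / (10 ^ 8 * (F.P K).d * (F.P K).L)) ^ 2) * b * ρ < 1) (hρ : 3 * ρ ≤ 1 / (10 ^ 8 * (F.P K).d * (F.P K).L)) :
    InjOn (fun B' : FluctIdx F k K → ℂ => B' + hopLinGraphC F k K Vk (recordCtC F k K Vk B')) (ball (0 : FluctIdx F k K → ℂ) (2 * ρ)) := by
  intro Y₁ hY₁ Y₂ hY₂ hΨ
  have hY₁' : ‖Y₁‖ < 2 * ρ := mem_ball_zero_iff.1 hY₁
  have hY₂' : ‖Y₂‖ < 2 * ρ := mem_ball_zero_iff.1 hY₂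
  have hρ0 : 0 < ρ := by linarith [norm_nonneg Y₁]
  have hC₂0 : (0 : ℝ) ≤ 2 * 1 / (1 / (10 ^ 8 * (F.P K).d * (F.P K).L)) ^ 2 := by positivity
  -- `Y₁ − Y₂ = −h_ℂ (C̃ Y₁ − C̃ Y₂)`
  have hdiff : Y₁ - Y₂ = -(hopLinGraphC F k K Vk (recordCtC F k K Vk Y₁ - recordCtC F k K Vk Y₂)) := by
    have h := hΨ
    simp only at h
    rw [map_sub]
    linear_combination (norm := skip) h
    abel
  have hle : ‖Y₁ - Y₂‖ ≤ 9 * (2 * 1 / (1 / (10 ^ 8 * (F.P K).d * (F.P K).L)) ^ 2) * b * ρ * ‖Y₁ - Y₂‖ := by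
    calc ‖Y₁ - Y₂‖ = ‖hopLinGraphC F k K Vk (recordCtC F k K Vk Y₁ - recordCtC F k K Vk Y₂)‖ := by rw [hdiff, norm_neg]
      _ ≤ b * ‖recordCtC F k K Vk Y₁ - recordCtC F k K Vk Y₂‖ := hHop _
      _ ≤ b * (9 * (2 * 1 / (1 / (10 ^ 8 * (F.P K).d * (F.P K).L)) ^ 2) * ρ * ‖Y₁ - Y₂‖) := by
          gcongr; exact norm_recordCtC_sub_le F k K hk Vk hε hε50 hVk hρ hY₁' hY₂'
      _ = 9 * (2 * 1 / (1 / (10 ^ 8 * (F.P K).d * (F.P K).L)) ^ 2) * b * ρ * ‖Y₁ - Y₂‖ := by ring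
  by_contra hne
  have hpos : 0 < ‖Y₁ - Y₂‖ := norm_pos_iff.2 (sub_ne_zero.2 hne)
  nlinarith

end Summit.QuantumFields.YangMills.Theorems.BalabanUVNodesPortS1

end
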